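import Literature.NumberTheory.Sieve.Maynard2016GPYWeights

/-!
# Maynard (2016), Lemma 6: the coupling sets and `ω_{m,q}(p) = 2k − #{(j,ℓ) : p ∣ mq(h_ℓ − h_j) − 1}`

Trunk: AntSieve / parity (Maynard 2016 large-gaps ladder, named fact
`Literature.NumberTheory.Sieve.Maynard2016.Lemma6MainTerm` of `Maynard2016Lemma6Split.lean`).

J. Maynard, *Large gaps between primes*, Ann. of Math. 183 (2016) = arXiv:1408.5110, §6, proof of
Lemma 6 (p. 10): in the Euler product of the main sum the `d_j`- and `e_ℓ`-variables interact at the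
primes `p ∣ m q (h_ℓ − h_j) − 1` ("we have terms involving the product of `d_j` and `e_ℓ` if
`p ∣ m q(h_ℓ − h_j) − 1`", display (6.13)), and for `w < p ≤ y` "the `h_i q (mod p)` are all distinct …
Therefore, recalling the definition (5.1) of `ω_{m,q}(p)`, we see that
`ω_{m,q}(p) = 2k − #{j, ℓ : p ∣ mq(h_ℓ − h_j) − 1}`".  This file PROVES that identity (in the form that
also covers the primes `p ∣ m`, where the `e`-conditions are void and `ω_{m,q}(p) = k`):
* `Maynard2016.couplingSet k x m q p` — the coupling set `{(j, ℓ) : p ∣ m q (h_ℓ − h_j) − 1}`;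
* `Maynard2016.omegaMQ_eq_card_zmod` — `ω_{m,q}(p)` counted on `ZMod p`;
* `Maynard2016.omegaMQ_add_card_couplingSet` — for a prime `p ∤ q` modulo which the `h_i` are
  distinct, `ω_{m,q}(p) + #couplingSet + k·[p ∣ m] = 2k`.

## References

* J. Maynard, *Large gaps between primes*, Ann. of Math. (2) 183 (2016), 915–933; arXiv:1408.5110,
  §5 display (5.1), §6 displays (6.13)–(6.16). [Maynard2016LargeGaps]
-/

noncomputable section

open Finset
open scoped BigOperators Classical

namespace Literature.NumberTheory.Sieve

namespace Maynard2016

/-! ### The coupling sets -/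

/-- The coupling set at `p`: `M_p = {(j, ℓ) : p ∣ m q (h_ℓ − h_j) − 1}` (divisibility in `ℤ`).
[cite: Maynard2016LargeGaps, §6 display (6.13)] -/
def couplingSet (k x m q p : ℕ) : Finset (Fin k × Fin k) :=
  Finset.univ.filter fun ij : Fin k × Fin k =>
    (p : ℤ) ∣ (m : ℤ) * q * ((hTuple k x ij.2 : ℤ) - hTuple k x ij.1) - 1

/-- Membership in the coupling set. [cite: Maynard2016LargeGaps, §6 display (6.13)] -/
theorem mem_couplingSet {k x m q p : ℕ} {i j : Fin k} :
    (i, j) ∈ couplingSet k x m q p ↔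
      (p : ℤ) ∣ (m : ℤ) * q * ((hTuple k x j : ℤ) - hTuple k x i) - 1 := by
  simp [couplingSet]

/-- At a prime `p ∣ m` the coupling set is empty. [cite: Maynard2016LargeGaps, §6 display (6.13)] -/
theorem couplingSet_eq_empty_of_dvd {k x m q p : ℕ} (hp : p.Prime) (hpm : p ∣ m) :
    couplingSet k x m q p = ∅ := by
  refine Finset.filter_eq_empty_iff.2 fun ij _ h => ?_
  have h1 : (p : ℤ) ∣ (m : ℤ) * q * ((hTuple k x ij.2 : ℤ) - hTuple k x ij.1) :=
    ((Int.natCast_dvd_natCast.2 hpm).mul_right _).mul_right _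
  have h2 : (p : ℤ) ∣ 1 := by
    have := h1.sub h
    simpa using this
  have : p ∣ 1 := by exact_mod_cast h2
  exact hp.one_lt.ne' (Nat.dvd_one.1 this)

/-! ### Counting `ω_{m,q}(p)` on `ZMod p` -/

/-- The residue predicate of (5.1) on `ZMod p`. [cite: Maynard2016LargeGaps, §5 display (5.1)] -/
def OmegaPred (k x m q p : ℕ) (r : ZMod p) : Prop :=
  ∃ i : Fin k, r + (hTuple k x i : ZMod p) * q = 0 ∨ (m : ZMod p) * (r + hTuple k x i * q) = 1

/-- The natural predicate of (5.1) agrees with `OmegaPred` on residues. [folklore] -/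
private theorem pred_iff {k x m q p : ℕ} (n : ℕ) :
    (∃ i : Fin k, p ∣ n + hTuple k x i * q ∨ m * (n + hTuple k x i * q) ≡ 1 [MOD p]) ↔
      OmegaPred k x m q p (n : ZMod p) := by
  unfold OmegaPred
  refine exists_congr fun i => ?_
  rw [← ZMod.natCast_eq_zero_iff, ← ZMod.natCast_eq_natCast_iff]
  push_cast
  exact Iff.rfl

/-- Two members of `[1, p]` with the same residue are equal. [folklore] -/
private theorem eq_of_cast_eq {p a b : ℕ} (ha : a ∈ Finset.Icc 1 p) (hb : b ∈ Finset.Icc 1 p)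
    (h : (a : ZMod p) = b) : a = b := by
  rw [Finset.mem_Icc] at ha hb
  rw [ZMod.natCast_eq_natCast_iff] at h
  -- `a ≡ b (mod p)` with `1 ≤ a, b ≤ p`
  rcases ha with ⟨ha1, hap⟩
  rcases hb with ⟨hb1, hbp⟩
  by_contra hne
  rcases Nat.lt_or_gt_of_ne hne with hlt | hlt
  · have h1 := (Nat.modEq_iff_dvd' hlt.le).1 h
    have : b - a < p := by omega
    have h0 : b - a = 0 := Nat.eq_zero_of_dvd_of_lt h1 this
    omega
  · have h1 := (Nat.modEq_iff_dvd' hlt.le).1 h.symm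
    have : a - b < p := by omega
    have h0 : a - b = 0 := Nat.eq_zero_of_dvd_of_lt h1 this
    omega

/-- **`ω_{m,q}(p)` counted on `ZMod p`** (`p ≥ 1`). [cite: Maynard2016LargeGaps, §5 display (5.1)] -/
theorem omegaMQ_eq_card_zmod (k x m q p : ℕ) [NeZero p] :
    omegaMQ k x m q p = (Finset.univ.filter fun r : ZMod p => OmegaPred k x m q p r).card := by
  have hp : 0 < p := Nat.pos_of_ne_zero (NeZero.ne p)
  unfold omegaMQ
  refine Finset.card_nbij (fun n : ℕ => (n : ZMod p)) (fun n hn => ?_) (fun a ha b hb h => ?_)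
    (fun r hr => ?_)
  · have hn' := (Finset.mem_filter.1 (Finset.mem_coe.1 hn)).2
    exact Finset.mem_coe.2 (Finset.mem_filter.2 ⟨Finset.mem_univ _, (pred_iff n).1 hn'⟩)
  · exact eq_of_cast_eq (Finset.mem_filter.1 (Finset.mem_coe.1 ha)).1
      (Finset.mem_filter.1 (Finset.mem_coe.1 hb)).1 h
  · have hr' := (Finset.mem_filter.1 (Finset.mem_coe.1 hr)).2
    by_cases h0 : r = 0
    · refine ⟨p, Finset.mem_coe.2 (Finset.mem_filter.2 ⟨Finset.mem_Icc.2 ⟨hp, le_rfl⟩,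
        (pred_iff p).2 ?_⟩), ?_⟩
      · rw [ZMod.natCast_self, ← h0]; exact hr'
      · show ((p : ℕ) : ZMod p) = r
        rw [ZMod.natCast_self, h0]
    · have hv : r.val ≠ 0 := fun h => h0 ((ZMod.val_eq_zero r).1 h)
      refine ⟨r.val, Finset.mem_coe.2 (Finset.mem_filter.2 ⟨Finset.mem_Icc.2
        ⟨Nat.one_le_iff_ne_zero.2 hv, (ZMod.val_lt r).le⟩, (pred_iff r.val).2 ?_⟩), ?_⟩
      · rw [ZMod.natCast_zmod_val]; exact hr'
      · exact ZMod.natCast_zmod_val r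

/-! ### The identity `ω_{m,q}(p) + #M_p + k[p ∣ m] = 2k` -/

section Count

variable {k x m q p : ℕ} (hp : p.Prime) (hpq : ¬ p ∣ q)
  (hdist : ∀ i j : Fin k, i ≠ j → ¬ (p : ℤ) ∣ (hTuple k x j : ℤ) - hTuple k x i)
include hp hpq hdist

/-- `i ↦ h_i q (mod p)` is injective. [folklore] -/
private theorem shift_injective :
    Function.Injective fun i : Fin k => (hTuple k x i : ZMod p) * q := by
  haveI := Fact.mk hp
  intro i j hij
  by_contra hne
  have hq0 : (q : ZMod p) ≠ 0 := by
    rw [Ne, ZMod.natCast_eq_zero_iff]; exact hpq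
  have h1 : (hTuple k x i : ZMod p) = hTuple k x j := mul_right_cancel₀ hq0 hij
  have h2 : (((hTuple k x j : ℤ) - hTuple k x i : ℤ) : ZMod p) = 0 := by
    push_cast; rw [h1, sub_self]
  exact hdist i j hne ((ZMod.intCast_zmod_eq_zero_iff_dvd _ p).1 h2)

/-- The set `A = {−h_i q}` of residues with `r + h_i q = 0` for some `i`. [folklore] -/
private theorem card_image_neg :
    (Finset.univ.image fun i : Fin k => -((hTuple k x i : ZMod p) * q)).card = k := by
  have hinj : Function.Injective fun i : Fin k => -((hTuple k x i : ZMod p) * q) :=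
    fun i j h => shift_injective hp hpq hdist (neg_injective h)
  rw [Finset.card_image_of_injective _ hinj, Finset.card_univ, Fintype.card_fin]

/-- The set `B = {m⁻¹ − h_i q}` of residues with `m(r + h_i q) = 1` for some `i`. [folklore] -/
private theorem card_image_inv_sub (c : ZMod p) :
    (Finset.univ.image fun i : Fin k => c - (hTuple k x i : ZMod p) * q).card = k := by
  have hinj : Function.Injective fun i : Fin k => c - (hTuple k x i : ZMod p) * q :=
    fun i j h => shift_injective hp hpq hdist (sub_right_injective h)
  rw [Finset.card_image_of_injective _ hinj, Finset.card_univ, Fintype.card_fin]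

omit hpq hdist in
/-- Membership in the coupling set, on `ZMod p`: `(i, j) ∈ M_p ↔ m q (h_j − h_i) = 1 (mod p)`. [folklore] -/
private theorem mem_couplingSet_iff_zmod {i j : Fin k} :
    (i, j) ∈ couplingSet k x m q p ↔
      (m : ZMod p) * q * ((hTuple k x j : ZMod p) - hTuple k x i) = 1 := by
  haveI := Fact.mk hp
  rw [mem_couplingSet, ← ZMod.intCast_zmod_eq_zero_iff_dvd]
  push_cast
  rw [sub_eq_zero]

/-- **`ω_{m,q}(p) = 2k − #{j, ℓ : p ∣ mq(h_ℓ − h_j) − 1}`** for a prime `p ∤ q` modulo which the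
`h_i` are distinct (e.g. `w < p ≤ y < q`), in the form covering also `p ∣ m` (where the coupling set is
empty and `ω_{m,q}(p) = k`): `ω_{m,q}(p) + #M_p + k·[p ∣ m] = 2k`. [cite: Maynard2016LargeGaps, §6 (proof of Lemma 6, after (6.13))] -/
theorem omegaMQ_add_card_couplingSet :
    omegaMQ k x m q p + (couplingSet k x m q p).card + (if p ∣ m then k else 0) = 2 * k := by
  haveI := Fact.mk hp
  set A : Finset (ZMod p) := Finset.univ.image fun i : Fin k => -((hTuple k x i : ZMod p) * q)
    with hA
  have hAcard : A.card = k := card_image_neg hp hpq hdist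
  have hmemA : ∀ r, r ∈ A ↔ ∃ i : Fin k, r + (hTuple k x i : ZMod p) * q = 0 := by
    intro r
    simp only [hA, Finset.mem_image, Finset.mem_univ, true_and]
    refine exists_congr fun i => ?_
    constructor
    · rintro h; rw [← h]; ring
    · intro h; linear_combination -h
  haveI : NeZero p := ⟨hp.ne_zero⟩
  rw [omegaMQ_eq_card_zmod k x m q p]
  by_cases hpm : p ∣ m
  · -- `p ∣ m`: the second family of conditions is void
    have hm0 : (m : ZMod p) = 0 := (ZMod.natCast_eq_zero_iff m p).2 hpm
    rw [if_pos hpm, couplingSet_eq_empty_of_dvd hp hpm, Finset.card_empty, add_zero]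
    have hS : (Finset.univ.filter fun r : ZMod p => OmegaPred k x m q p r) = A := by
      ext r
      rw [Finset.mem_filter, hmemA]
      simp only [Finset.mem_univ, true_and, OmegaPred, hm0, zero_mul, zero_ne_one, or_false]
    rw [hS, hAcard]; ring
  · -- `p ∤ m`: two families of `k` residues each, meeting in `#M_p` residues
    have hm0 : (m : ZMod p) ≠ 0 := by rw [Ne, ZMod.natCast_eq_zero_iff]; exact hpm
    set B : Finset (ZMod p) := Finset.univ.image fun i : Fin k =>
      (m : ZMod p)⁻¹ - (hTuple k x i : ZMod p) * q with hB
    have hBcard : B.card = k := card_image_inv_sub hp hpq hdist _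
    have hmemB : ∀ r, r ∈ B ↔ ∃ i : Fin k, (m : ZMod p) * (r + hTuple k x i * q) = 1 := by
      intro r
      simp only [hB, Finset.mem_image, Finset.mem_univ, true_and]
      refine exists_congr fun i => ?_
      constructor
      · rintro h; rw [← h, sub_add_cancel, mul_inv_cancel₀ hm0]
      · intro h
        have : r + (hTuple k x i : ZMod p) * q = (m : ZMod p)⁻¹ :=
          (inv_eq_of_mul_eq_one_right h).symm
        rw [← this, add_sub_cancel_right]
    have hS : (Finset.univ.filter fun r : ZMod p => OmegaPred k x m q p r) = A ∪ B := by
      ext r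
      rw [Finset.mem_filter, Finset.mem_union, hmemA, hmemB]
      simp only [Finset.mem_univ, true_and, OmegaPred]
      constructor
      · rintro ⟨i, h | h⟩
        · exact Or.inl ⟨i, h⟩
        · exact Or.inr ⟨i, h⟩
      · rintro (⟨i, h⟩ | ⟨i, h⟩)
        · exact ⟨i, Or.inl h⟩
        · exact ⟨i, Or.inr h⟩
    -- `A ∩ B` is in bijection with the coupling set via `(i, j) ↦ −h_i q`
    have hinter : (A ∩ B).card = (couplingSet k x m q p).card := by
      symm
      refine Finset.card_nbij (fun ij : Fin k × Fin k => -((hTuple k x ij.1 : ZMod p) * q))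
        (fun ij hij => ?_) (fun ij hij ij' hij' h => ?_) (fun r hr => ?_)
      · obtain ⟨i, j⟩ := ij
        have h1 := (mem_couplingSet_iff_zmod hp).1 (Finset.mem_coe.1 hij)
        refine Finset.mem_coe.2 (Finset.mem_inter.2 ⟨(hmemA _).2 ⟨i, by ring⟩, (hmemB _).2 ⟨j, ?_⟩⟩)
        rw [← h1]; ring
      · obtain ⟨i, j⟩ := ij
        obtain ⟨i', j'⟩ := ij'
        have h1 := (mem_couplingSet_iff_zmod hp).1 (Finset.mem_coe.1 hij)
        have h2 := (mem_couplingSet_iff_zmod hp).1 (Finset.mem_coe.1 hij')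
        have hii' : i = i' := shift_injective hp hpq hdist (neg_injective h)
        subst hii'
        have hq0 : (q : ZMod p) ≠ 0 := by rw [Ne, ZMod.natCast_eq_zero_iff]; exact hpq
        have h3 : (m : ZMod p) * q * (hTuple k x j : ZMod p) = (m : ZMod p) * q * hTuple k x j' := by
          have := h1.trans h2.symm
          have e : (m : ZMod p) * q * ((hTuple k x j : ZMod p) - hTuple k x i) -
              (m : ZMod p) * q * ((hTuple k x j' : ZMod p) - hTuple k x i) = 0 := by
            rw [this, sub_self]
          rw [← sub_eq_zero, ← e]; ring
        have h4 : (hTuple k x j : ZMod p) * q = hTuple k x j' * q := by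
          have := mul_left_cancel₀ (mul_ne_zero hm0 hq0) h3
          rw [this]
        have hjj' : j = j' := shift_injective hp hpq hdist h4
        rw [hjj']
      · obtain ⟨hrA, hrB⟩ := Finset.mem_inter.1 (Finset.mem_coe.1 hr)
        obtain ⟨i, hi⟩ := (hmemA r).1 hrA
        obtain ⟨j, hj⟩ := (hmemB r).1 hrB
        have hr' : r = -((hTuple k x i : ZMod p) * q) := by linear_combination hi
        refine ⟨(i, j), Finset.mem_coe.2 ((mem_couplingSet_iff_zmod hp).2 ?_), hr'.symm⟩
        rw [← hj, hr']; ring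
    rw [hS, if_neg hpm, add_zero, ← hinter, Finset.card_union_add_card_inter, hAcard, hBcard]
    ring

end Count

end Maynard2016

end Literature.NumberTheory.Sieve

end
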